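import Summits.Ventures.CertifiedArithmetic.LowPrec.GemmEnvelopeRowP5

/-!
# GEMM-level envelopes, part (o): row P5 decided UNDER THE PIPELINES (pub-lowprec gemm gen 22, LXX-o)

HONEST FRAMING: certified error envelopes and provably optimal rounding/accumulation schemes for
low-precision formats under stated cost models; every table by two implementations; no hardware or
vendor claims.

Rows (d)–(m) compare quantisers under exact accumulation.  This file states row P5 («MX-E4M3-ceil vs
per-vector E4M3») with the accumulation and output models switched on, in the hypothesis-defined pipeline
style of parts (b)/(g)/(i): accumulation `|acc - ΣΣ q̂a q̂b| ≤ γ·ΣΣ|q̂a q̂b|` with `γ ≤ 1/2048` (covers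
Binary32 two-level accumulation with `k + B ≤ 8193` and any-order Binary32 accumulation with `K ≤ 8193`,
sharp unit `1/16777217`), output `|c - acc| ≤ δ|acc|` with `δ ≤ 1/257` (BFloat16 or finer).
* `row_P5_vec_le_pipelines`: on `C(κ)`, `κ ≤ 28672`, EVERY per-vector-E4M3 pipeline output satisfies
  `|c - S| ≤ C_P5·L`, `C_P5 = 35/289 + (1/2048)(324/289) + (1/257)(324/289)(1 + 1/2048) ≈ 0.126019`
  (from `gemm_vec_envelope_E4M3`, monotone in `γ, δ`).
* `row_P5_mx_fails_pipelines`: for `κ ≥ 16384` (blocks of length `≥ 3`) the MX-ceil input with blocks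
  `(240, 0, v, …, v)·(0, 240, v, …, v)`, `v = 15/1024 + 2⁻²⁰` (scale `1`, `v ↦ 1/64`), has
  `C_P5·L < |c - S|` for EVERY accumulation / output realisation within the model: the realised value is at
  least `(1 - γ)(1 - δ)·Q`, `Q = ΣΣ q̂a q̂b = L/(4096 v²)`, and `(C_P5 + 1)·v² < (2047/2048)(256/257)/4096`.
Hence for `16384 ≤ κ ≤ 28672` row P5 is decided under the pipelines, not only at the quantiser level:
`sup_{C(κ)} F1_full(VEC) ≤ C_P5 < F1_full(MX witness)`.  Just above `θ = 258048/17` the quantiser-level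
margin tends to `0` and no such statement holds uniformly in the realisation (part (n), cert
GEMM-ENVELOPES-ROBUST.json). [cite: RouhaniEtAl2023MX, §6.3]; [cite: Higham2002ASNA, §3.1]
-/

namespace Summit.Ventures.CertifiedArithmetic.LowPrec.GemmEnvelope

open Finset
open Literature.ComputerArithmetic.FloatingPoint
open Literature.ComputerArithmetic.FloatingPoint.Format
open Literature.ComputerArithmetic.FloatingPoint.MiniFloat
open Literature.ComputerArithmetic.FloatingPoint.MXBlock
open Summit.Ventures.CertifiedArithmetic.LowPrec.SR

/-- THE TIE SIDE UNDER THE PIPELINES: per-vector E4M3 on `C(κ)`, `κ ≤ 28672`, any accumulation with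
`γ ≤ 1/2048` and output with `δ ≤ 1/257`: `|c - Σ ab| ≤ C_P5 · Σ|ab|`. [cite: Higham2002ASNA, §3.1] -/
theorem row_P5_vec_le_pipelines {ι : Type*} [Fintype ι] (a b qa qb : ι → ℚ)
    {Aa Ab κ γ δ acc c : ℚ} (hγ0 : 0 ≤ γ) (hγ : γ ≤ 1 / 2048) (hδ0 : 0 ≤ δ) (hδ : δ ≤ 1 / 257)
    (hκ : κ ≤ 28672) (hAa : ∀ i, |a i| ≤ Aa) (hAb : ∀ i, |b i| ≤ Ab)
    (hca : ∀ i, a i = 0 ∨ Aa ≤ κ * |a i|) (hcb : ∀ i, b i = 0 ∨ Ab ≤ κ * |b i|)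
    (hqa : ∀ i, qa i = Aa / E4M3.maxRat * (roundNE E4M3 (a i / (Aa / E4M3.maxRat))).toRat)
    (hqb : ∀ i, qb i = Ab / E4M3.maxRat * (roundNE E4M3 (b i / (Ab / E4M3.maxRat))).toRat)
    (hacc : |acc - ∑ i, qa i * qb i| ≤ γ * ∑ i, |qa i * qb i|) (hc : |c - acc| ≤ δ * |acc|) :
    |c - ∑ i, a i * b i|
      ≤ (35 / 289 + 1 / 2048 * (324 / 289) + 1 / 257 * (324 / 289) * (1 + 1 / 2048)) * ∑ i, |a i * b i| := by
  have h := gemm_vec_envelope_E4M3 a b qa qb hγ0 hδ0 hκ hAa hAb hca hcb hqa hqb hacc hc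
  have hL : 0 ≤ ∑ i, |a i * b i| := sum_nonneg fun i _ => abs_nonneg _
  have hcoef : 35 / 289 + γ * (324 / 289) + δ * (324 / 289) * (1 + γ)
      ≤ 35 / 289 + 1 / 2048 * (324 / 289) + 1 / 257 * (324 / 289) * (1 + 1 / 2048) := by
    nlinarith [mul_le_mul hδ (by linarith : 1 + γ ≤ 1 + 1 / 2048) (by linarith) (by norm_num : (0:ℚ) ≤ 1 / 257)]
  exact le_trans h (mul_le_mul_of_nonneg_right hcoef hL)

/-- THE SEPARATING SIDE UNDER THE PIPELINES: for `κ ≥ 16384` (blocks `≥ 3`) an MX-E4M3-ceil input in `C(κ)`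
whose output error exceeds `C_P5 · L` for EVERY accumulation realisation with `γ ≤ 1/2048` and output with
`δ ≤ 1/257`. [cite: RouhaniEtAl2023MX, §6.3] -/
theorem row_P5_mx_fails_pipelines {B k : ℕ} (hB : 0 < B) (hk : 3 ≤ k) {κ : ℚ} (hκ : 16384 ≤ κ) :
    ∃ (a b : Fin B → Fin k → ℚ) (Aa Ab : ℚ),
      (∀ j i, |a j i| ≤ Aa ∧ (a j i = 0 ∨ Aa ≤ κ * |a j i|)) ∧
      (∀ j i, |b j i| ≤ Ab ∧ (b j i = 0 ∨ Ab ≤ κ * |b j i|)) ∧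
      ∀ (γ δ acc c : ℚ), γ ≤ 1 / 2048 → δ ≤ 1 / 257 →
        |acc - ∑ j, ∑ i, (ceilScale E4M3 (a j) * (roundNE E4M3 (a j i / ceilScale E4M3 (a j))).toRat) *
            (ceilScale E4M3 (b j) * (roundNE E4M3 (b j i / ceilScale E4M3 (b j))).toRat)|
          ≤ γ * ∑ j, ∑ i, |(ceilScale E4M3 (a j) * (roundNE E4M3 (a j i / ceilScale E4M3 (a j))).toRat) *
            (ceilScale E4M3 (b j) * (roundNE E4M3 (b j i / ceilScale E4M3 (b j))).toRat)| →
        |c - acc| ≤ δ * |acc| →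
        (35 / 289 + 1 / 2048 * (324 / 289) + 1 / 257 * (324 / 289) * (1 + 1 / 2048))
            * ∑ j, ∑ i, |a j i * b j i| < |c - ∑ j, ∑ i, a j i * b j i| := by
  obtain ⟨n, rfl⟩ : ∃ n, k = n + 3 := ⟨k - 3, by omega⟩
  have hM : E4M3.maxRat = 448 := by decide +kernel
  have hMpos : 0 < E4M3.maxRat := by rw [hM]; norm_num
  set v : ℚ := 15361 / 1048576 with hvdef
  have hv0 : (0 : ℚ) < v := by rw [hvdef]; norm_num
  have hv15 : 15 / 1024 < v := by rw [hvdef]; norm_num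
  have hv16 : v ≤ 1 / 64 := by rw [hvdef]; norm_num
  have hv240 : v ≤ 240 := by rw [hvdef]; norm_num
  have hκv : (240 : ℚ) ≤ κ * v := by
    rw [hvdef]; nlinarith
  have hκ240 : (240 : ℚ) ≤ κ * 240 := by nlinarith
  have h64 : (roundNE E4M3 v).toRat = 1 / 64 := toRat_roundNE_E4M3_eq_inv64 hv15 hv16
  have h240 : (roundNE E4M3 240).toRat = 240 := by decide +kernel
  have hpos240 : (0 : ℚ) < 240 := by norm_num
  -- the blocks
  set a' : Fin (n + 3) → ℚ := Fin.cases (240 : ℚ) (Fin.cases (0 : ℚ) (fun _ : Fin (n + 1) => v)) with ha'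
  set b' : Fin (n + 3) → ℚ := Fin.cases (0 : ℚ) (Fin.cases (240 : ℚ) (fun _ : Fin (n + 1) => v)) with hb'
  have haM : ∀ i, |a' i| ≤ 240 := by
    intro i; rw [ha']
    refine Fin.cases ?_ (fun i' => Fin.cases ?_ (fun _ => ?_) i') i
    · simp only [Fin.cases_zero]; rw [abs_of_pos hpos240]
    · simp only [Fin.cases_succ, Fin.cases_zero, abs_zero]; exact hpos240.le
    · simp only [Fin.cases_succ]; rwa [abs_of_pos hv0]
  have hbM : ∀ i, |b' i| ≤ 240 := by
    intro i; rw [hb']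
    refine Fin.cases ?_ (fun i' => Fin.cases ?_ (fun _ => ?_) i') i
    · simp only [Fin.cases_zero, abs_zero]; exact hpos240.le
    · simp only [Fin.cases_succ, Fin.cases_zero]; rw [abs_of_pos hpos240]
    · simp only [Fin.cases_succ]; rwa [abs_of_pos hv0]
  have ha0 : |a' 0| = 240 := by rw [ha']; simp only [Fin.cases_zero]; rw [abs_of_pos hpos240]
  have hb1 : |b' (Fin.succ 0)| = 240 := by
    rw [hb']; simp only [Fin.cases_succ, Fin.cases_zero]; rw [abs_of_pos hpos240]
  have hBa : blockMax a' = 240 := blockMax_eq_of_forall_le haM ha0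
  have hBb : blockMax b' = 240 := blockMax_eq_of_forall_le hbM hb1
  -- the ceil scales are `2^0 = 1`
  have hsa : ceilScale E4M3 a' = 1 := by
    have := ceilScale_eq_zpow (φ := E4M3) hMpos (V := a') (e := 0)
      (by rw [hBa, hM]; norm_num) (by rw [hBa, hM]; norm_num)
    simpa using this
  have hsb : ceilScale E4M3 b' = 1 := by
    have := ceilScale_eq_zpow (φ := E4M3) hMpos (V := b') (e := 0)
      (by rw [hBb, hM]; norm_num) (by rw [hBb, hM]; norm_num)
    simpa using this
  have hmemA : ∀ (j : Fin B) (i : Fin (n + 3)), |(fun _ : Fin B => a') j i| ≤ 240 ∧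
      ((fun _ : Fin B => a') j i = 0 ∨ (240 : ℚ) ≤ κ * |(fun _ : Fin B => a') j i|) := by
    intro j i; refine ⟨haM i, ?_⟩
    show a' i = 0 ∨ (240 : ℚ) ≤ κ * |a' i|
    rw [ha']
    refine Fin.cases ?_ (fun i' => Fin.cases ?_ (fun _ => ?_) i') i
    · simp only [Fin.cases_zero]; rw [abs_of_pos hpos240]; exact Or.inr hκ240
    · simp only [Fin.cases_succ, Fin.cases_zero]
      first | exact Or.inl rfl | exact Or.inl trivial
    · simp only [Fin.cases_succ]; rw [abs_of_pos hv0]; exact Or.inr hκv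
  have hmemB : ∀ (j : Fin B) (i : Fin (n + 3)), |(fun _ : Fin B => b') j i| ≤ 240 ∧
      ((fun _ : Fin B => b') j i = 0 ∨ (240 : ℚ) ≤ κ * |(fun _ : Fin B => b') j i|) := by
    intro j i; refine ⟨hbM i, ?_⟩
    show b' i = 0 ∨ (240 : ℚ) ≤ κ * |b' i|
    rw [hb']
    refine Fin.cases ?_ (fun i' => Fin.cases ?_ (fun _ => ?_) i') i
    · simp only [Fin.cases_zero]
      first | exact Or.inl rfl | exact Or.inl trivial
    · simp only [Fin.cases_succ, Fin.cases_zero]; rw [abs_of_pos hpos240]; exact Or.inr hκ240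
    · simp only [Fin.cases_succ]; rw [abs_of_pos hv0]; exact Or.inr hκv
  -- the four block sums
  have hS1 : ∑ i, (roundNE E4M3 (a' i)).toRat * (roundNE E4M3 (b' i)).toRat
      = ((n + 1 : ℕ) : ℚ) * (1 / 64 * (1 / 64)) := by
    rw [Fin.sum_univ_succ, Fin.sum_univ_succ, ha', hb']
    simp only [Fin.cases_zero, Fin.cases_succ, h64, h240, toRat_roundNE_zero, mul_zero, zero_mul,
      zero_add, sum_const, card_univ, Fintype.card_fin, nsmul_eq_mul]
  have hS1a : ∑ i, |(roundNE E4M3 (a' i)).toRat * (roundNE E4M3 (b' i)).toRat|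
      = ((n + 1 : ℕ) : ℚ) * (1 / 64 * (1 / 64)) := by
    rw [Fin.sum_univ_succ, Fin.sum_univ_succ, ha', hb']
    simp only [Fin.cases_zero, Fin.cases_succ, h64, h240, toRat_roundNE_zero, mul_zero, zero_mul, abs_zero,
      zero_add, sum_const, card_univ, Fintype.card_fin, nsmul_eq_mul,
      abs_of_pos (by norm_num : (0:ℚ) < 1 / 64 * (1 / 64))]
  have hS2 : ∑ i, a' i * b' i = ((n + 1 : ℕ) : ℚ) * (v * v) := by
    rw [Fin.sum_univ_succ, Fin.sum_univ_succ, ha', hb']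
    simp only [Fin.cases_zero, Fin.cases_succ, mul_zero, zero_mul, zero_add, sum_const, card_univ,
      Fintype.card_fin, nsmul_eq_mul]
  have hS3 : ∑ i, |a' i * b' i| = ((n + 1 : ℕ) : ℚ) * (v * v) := by
    rw [Fin.sum_univ_succ, Fin.sum_univ_succ, ha', hb']
    simp only [Fin.cases_zero, Fin.cases_succ, mul_zero, zero_mul, abs_zero, zero_add, sum_const,
      card_univ, Fintype.card_fin, nsmul_eq_mul, abs_of_pos (mul_pos hv0 hv0)]
  refine ⟨fun _ => a', fun _ => b', 240, 240, hmemA, hmemB, ?_⟩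
  intro γ δ acc c hγ hδ hacc hc
  simp only [hsa, hsb, div_one, one_mul, hS1, hS1a, hS2, hS3, sum_const, card_univ, Fintype.card_fin,
    nsmul_eq_mul] at hacc ⊢
  clear hmemA hmemB hS1 hS1a hS2 hS3 hsa hsb hBa hBb ha0 hb1 haM hbM h64 h240
  have hBn : (0 : ℚ) < (B : ℚ) * ((n + 1 : ℕ) : ℚ) := by
    have : (0 : ℚ) < (B : ℚ) := by exact_mod_cast hB
    positivity
  have eQ : (B : ℚ) * (((n + 1 : ℕ) : ℚ) * (1 / 64 * (1 / 64))) = ((B : ℚ) * ((n + 1 : ℕ) : ℚ)) * (1 / 4096) := by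
    ring
  have eS : (B : ℚ) * (((n + 1 : ℕ) : ℚ) * (v * v)) = ((B : ℚ) * ((n + 1 : ℕ) : ℚ)) * (v * v) := by ring
  rw [eQ] at hacc
  rw [eS]
  generalize hN : (B : ℚ) * ((n + 1 : ℕ) : ℚ) = N at hacc hBn ⊢
  -- `acc ≥ (1 - γ) Q ≥ (2047/2048) Q > 0`, `c ≥ (1 - δ) acc ≥ (256/257) acc`
  have hQpos : 0 < N * (1 / 4096) := by positivity
  have hacc' : N * (1 / 4096) - γ * (N * (1 / 4096)) ≤ acc := by
    have := (abs_le.mp hacc).1; linarith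
  have hγQ : γ * (N * (1 / 4096)) ≤ 1 / 2048 * (N * (1 / 4096)) := mul_le_mul_of_nonneg_right hγ hQpos.le
  have haccpos : 0 < acc := by linarith
  have hc' : acc - δ * acc ≤ c := by
    have := (abs_le.mp hc).1; rw [abs_of_pos haccpos] at this; linarith
  have hδacc : δ * acc ≤ 1 / 257 * acc := mul_le_mul_of_nonneg_right hδ haccpos.le
  have hclow : N * (1 / 4096) * (2047 / 2048) * (256 / 257) ≤ c := by linarith
  have hnum : (35 / 289 + 1 / 2048 * (324 / 289) + 1 / 257 * (324 / 289) * (1 + 1 / 2048) + 1) * (v * v)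
      < 1 / 4096 * (2047 / 2048) * (256 / 257) := by rw [hvdef]; norm_num
  have hkey := mul_lt_mul_of_pos_left hnum hBn
  have hgoal : (35 / 289 + 1 / 2048 * (324 / 289) + 1 / 257 * (324 / 289) * (1 + 1 / 2048)) * (N * (v * v))
      < c - N * (v * v) := by linarith
  have hpos : 0 < c - N * (v * v) := by
    have : 0 ≤ (35 / 289 + 1 / 2048 * (324 / 289) + 1 / 257 * (324 / 289) * (1 + 1 / 2048)) * (N * (v * v)) := by
      positivity
    exact lt_of_le_of_lt this hgoal
  rwa [abs_of_pos hpos]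

end Summit.Ventures.CertifiedArithmetic.LowPrec.GemmEnvelope
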